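import Summits.QuantumFields.BalabanUV.Beta.SecondOrderSplitDecay
import Summits.QuantumFields.BalabanUV.Beta.KernelWardResponse

/-!
# `BalabanUV.Beta.SecondOrderSplitLoc` — binder row D1, (L4) W-side: the three `Loc` sockets of the staged W-END (hDg) / (hΔL) / (hX2L)
# DISCHARGED FROM DECAY, generic `K` — (HR-W-SPLIT-LOC)
# (β sub-cell, D1 formalisation swarm, unit `b2b-balaban-beta-d1-formalise-leaf-10`, gen 2; CLAIM «D1-hR-L4-SPLIT-LOC», typer-g4 row l.≈10803)

NOT IN PRINT; OUR BOOKKEEPING.  HONEST FRAMING (cell contract, verbatim): «discharging `BetaPertH` makes Bałaban's UV stability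
UNCONDITIONAL — a real constructive-QFT result; it is NOT the continuum limit and NOT the Clay problem.»  HONEST DEPENDENCY (verbatim):
«continuum YM on T⁴ ⇐ BetaPertH ∧ nine spine estimates (0/9 proved); BetaPertH ⇐ (D1) ∧ (D4) ∧ CAP+tail; G-an2-4 gates asym, D1 and
NE2/3/4.»  [folklore] analysis bookkeeping; instantiates NO binder of the β-function wall; no `[cite:]`, no `def`, no `def … : Prop`; NOT D1,
NOT `BetaPertH`, NOT continuum, NOT Clay.

## What (the typer-g4 cut, generic kernel `K`)

* (LOC-♯) `locStencil_conjV_diagK`, **`locStencil_sharp`**: the ♯-table `κ u ↦ S κ u + conjV 𝕄 (diagK (g κ u))` is a local stencil family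
  (`Decays 𝕄`, `LocStencil S`, bi-localised diagonal generator family) ⇒ **`loc_dM_sharp`** = socket (hDg): `Loc (dM K N S♯ M ν y′)`.
* (LOC-Ξ) **`loc_dM_Xi`** = socket (hΔL): `Loc (dM (−(K∘conjV 𝕄 (diagK G)∘K)) N S M μ y)` for a localised diagonal `diagK G` (and its dressed
  form `G = Σ colH K N ν y′ · g`, `loc_dM_Xi_dressed`).
* (LOC-X₂⋆) `diagK_add'`, `diagK_dressed₂_eq_vertex2OfK`, **`loc_diagK_secondSymbol`** = socket (hX2L): `Loc (diagK X₂⋆)` for the DISPLAYED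
  second symbol of `SecondOrderContactAssembly.W2OfK_sharp_split`, from `LocStencil₂ (κ u κ′ u′ ↦ diagK (h κ u κ′ u′))` (the decay class of
  the free second symbol `h`) and the bi-localised `g`.
Suppliers BY NAME: `ExpKernelCalculus.biLoc_comp_decays`, `BalabanStepJetsSucc.biLoc_comp_right`, `KernelWard.biLoc_sub`, `StepJetData.locStencil_add`,
`SecondOrderTransport.loc_dM`, `KernelWardResponse.decays_of_biLoc`, `SecondOrderResponse.vertexFamily_K2OfK`/`vertexFamily₂_vertex2OfK`,
`OneStepKernelFamily.vertexFamily_vertexOfK'`, `ChartConjugation.loc_conjV`, `TameKernelCalculus` (`Spr.comp_loc`, `Loc.comp_spr`, `Loc.neg`, `Loc.add`).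
-/

noncomputable section

open Finset
open scoped BigOperators
open Literature.MathematicalPhysics.QuantumFieldTheory
open Literature.MathematicalPhysics.QuantumFieldTheory.Balaban1983to89
open Literature.MathematicalPhysics.QuantumFieldTheory.Balaban1983to89.Beta
open B12Sec2to5 (l1 l1_nonneg)
open ExpKernelCalculus (MKer Decays BiLoc VertexFamily VertexFamily₂ comp Zl Zl_nonneg biLoc_comp_decays)
open KernelWard (bdd_of_biLoc biLoc_sub biLoc_add)
open OneStepResolventKernel (Fib wsum LocStencil biLoc_mono decays_mono)
open OneStepKernelFamily (colH vertexOfK vertexFamily_vertexOfK')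
open BalabanCompositeJets (LocStencil₂)
open BalabanStepJets (locStencil_mono)
open BalabanStepJetsSucc (biLoc_comp_right)
open StepJetData (locStencil_add)
open SecondOrderResponse (colM vertexOfM dM K2OfK vertex2OfK vertexFamily_K2OfK vertexFamily₂_vertex2OfK)
open Summit.QuantumFields.BalabanUV.Beta.TameKernelCalculus
open Summit.QuantumFields.BalabanUV.Beta.ChartConjugation (conjV loc_conjV)
open Summit.QuantumFields.BalabanUV.Beta.BorderedHessian (diagK diagK_apply)
open Summit.QuantumFields.BalabanUV.Beta.SecondOrderTransport (loc_dM)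
open Summit.QuantumFields.BalabanUV.Beta.KernelWardResponse (decays_of_biLoc)
open Summit.QuantumFields.BalabanUV.Beta.SecondOrderSplitDecay (diagK_dressed_eq_vertexOfK)

namespace Summit.QuantumFields.BalabanUV.Beta.SecondOrderSplitLoc

variable {d N : ℕ}

/-! ## §1 (LOC-♯): the ♯-table is a local stencil family; socket (hDg) -/

/-- [folklore] **THE CONJUGATED DIAGONAL FAMILY IS A LOCAL STENCIL FAMILY**: `Decays 𝕄 C𝕄 m` and `LocStencil (κ u ↦ diagK (g κ u)) Cg m` ⇒
`LocStencil (κ u ↦ conjV 𝕄 (diagK (g κ u))) (2·#F·C𝕄·Cg·Zl (m/2)) (m/2)`. -/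
theorem locStencil_conjV_diagK {𝕄 : MKer (d + 1) (Fib d)} {C𝕄 m : ℝ} (h𝕄 : Decays 𝕄 C𝕄 m) (hm : 0 < m)
    {g : Fin (d + 1) → (Fin (d + 1) → ℤ) → (Fin (d + 1) → ℤ) → Fib d → ℝ} {Cg : ℝ} (hgl : LocStencil (fun κ u => diagK (g κ u)) Cg m) :
    LocStencil (fun κ u => conjV 𝕄 (diagK (g κ u)))
      ((Fintype.card (Fib d) : ℝ) * (C𝕄 * Cg) * Zl (d + 1) (m - m / 2) + (Fintype.card (Fib d) : ℝ) * (Cg * C𝕄) * Zl (d + 1) (m - m / 2))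
      (m / 2) := by
  intro κ u
  have h0 : (0 : ℝ) ≤ m / 2 := by positivity
  have h1 : m / 2 < m := half_lt_self hm
  exact biLoc_sub (biLoc_comp_decays h𝕄 (hgl κ u) h0 h1) (biLoc_comp_right (hgl κ u) h𝕄 h0 h1)

/-- [folklore] **THE ♯-TABLE `κ u ↦ S κ u + conjV 𝕄 (diagK (g κ u))` IS A LOCAL STENCIL FAMILY** (rate `m/2`). -/
theorem locStencil_sharp {𝕄 : MKer (d + 1) (Fib d)} {C𝕄 m : ℝ} (h𝕄 : Decays 𝕄 C𝕄 m) (hm : 0 < m)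
    {S : Fin (d + 1) → (Fin (d + 1) → ℤ) → MKer (d + 1) (Fib d)} {Cs : ℝ} (hS : LocStencil S Cs m)
    {g : Fin (d + 1) → (Fin (d + 1) → ℤ) → (Fin (d + 1) → ℤ) → Fib d → ℝ} {Cg : ℝ} (hgl : LocStencil (fun κ u => diagK (g κ u)) Cg m) :
    LocStencil (fun κ u => S κ u + conjV 𝕄 (diagK (g κ u)))
      (Cs + ((Fintype.card (Fib d) : ℝ) * (C𝕄 * Cg) * Zl (d + 1) (m - m / 2) + (Fintype.card (Fib d) : ℝ) * (Cg * C𝕄) * Zl (d + 1) (m - m / 2)))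
      (m / 2) :=
  locStencil_add (locStencil_mono hS ((hS 0 0).nonneg (Sum.inl 0)) (half_le_self hm.le)) (locStencil_conjV_diagK h𝕄 hm hgl)

/-- [folklore] **SOCKET (hDg): THE LAGRANGIAN-CHART VERTEX OVER THE ♯-TABLE IS LOCALISED** — decaying `K`, decaying `𝕄`, local `S`, coarse-local
`M` (rates `m`, `M` at any rate ≥ `m/2`), bi-localised diagonal generator family. -/
theorem loc_dM_sharp [NeZero N] {K 𝕄 : MKer (d + 1) (Fib d)} {C C𝕄 m : ℝ} (hKd : Decays K C m) (hC : 0 ≤ C) (h𝕄 : Decays 𝕄 C𝕄 m) (hm : 0 < m)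
    {S : Fin (d + 1) → (Fin (d + 1) → ℤ) → MKer (d + 1) (Fib d)} {Cs : ℝ} (hS : LocStencil S Cs m)
    {M : Fin (d + 1) → (Fin (d + 1) → ℤ) → MKer (d + 1) (Fib d)} {CM : ℝ} (hM : VertexFamily M N CM m)
    {g : Fin (d + 1) → (Fin (d + 1) → ℤ) → (Fin (d + 1) → ℤ) → Fib d → ℝ} {Cg : ℝ} (hgl : LocStencil (fun κ u => diagK (g κ u)) Cg m)
    (ν : Fin (d + 1)) (y' : Fin (d + 1) → ℤ) :
    Loc (dM K N (fun κ u => S κ u + conjV 𝕄 (diagK (g κ u))) M ν y') := by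
  have hM' : VertexFamily M N CM (m / 2) := fun μ y => biLoc_mono (hM μ y) ((hM 0 0).nonneg (Sum.inl 0)) (half_le_self hm.le)
  exact loc_dM hKd hC (locStencil_sharp h𝕄 hm hS hgl) hM' (half_pos hm) (half_le_self hm.le) ν y'

/-! ## §2 (LOC-Ξ): socket (hΔL) -/

/-- [folklore] The residual kernel `Ξ := −(K∘conjV 𝕄 (diagK G)∘K)` is localised (spread `K`, `𝕄`; localised diagonal). -/
theorem loc_Xi {K 𝕄 : MKer (d + 1) (Fib d)} (hKs : Spr K) (h𝕄 : Spr 𝕄) {G : (Fin (d + 1) → ℤ) → Fib d → ℝ} (hG : Loc (diagK G)) :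
    Loc (-(comp (comp K (conjV 𝕄 (diagK G))) K)) :=
  ((hKs.comp_loc (loc_conjV h𝕄 hG)).comp_spr hKs).neg

/-- [folklore] **SOCKET (hΔL): THE LAGRANGIAN-CHART VERTEX OF THE RESIDUAL KERNEL IS LOCALISED** — `Loc (dM Ξ N S M μ y)` for local `S`,
coarse-local `M`, any positive table rate. -/
theorem loc_dM_Xi [NeZero N] {K 𝕄 : MKer (d + 1) (Fib d)} (hKs : Spr K) (h𝕄 : Spr 𝕄) {G : (Fin (d + 1) → ℤ) → Fib d → ℝ} (hG : Loc (diagK G))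
    {S : Fin (d + 1) → (Fin (d + 1) → ℤ) → MKer (d + 1) (Fib d)} {Cs m : ℝ} (hS : LocStencil S Cs m) (hm : 0 < m)
    {M : Fin (d + 1) → (Fin (d + 1) → ℤ) → MKer (d + 1) (Fib d)} {CM : ℝ} (hM : VertexFamily M N CM m)
    (μ : Fin (d + 1)) (y : Fin (d + 1) → ℤ) :
    Loc (dM (-(comp (comp K (conjV 𝕄 (diagK G))) K)) N S M μ y) := by
  obtain ⟨p, q, CΞ, δΞ, hδΞ, hΞ⟩ := loc_Xi hKs h𝕄 hG
  have hΞd := decays_of_biLoc hΞ hδΞ.le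
  have hCΞ : 0 ≤ CΞ * Real.exp (δΞ * l1 (p - q)) := mul_nonneg (hΞ.nonneg (Sum.inl 0)) (Real.exp_pos _).le
  set δ₀ := min m δΞ
  have hδ₀ : 0 < δ₀ := lt_min hm hδΞ
  have hS' : LocStencil S Cs δ₀ := locStencil_mono hS ((hS 0 0).nonneg (Sum.inl 0)) (min_le_left _ _)
  have hM' : VertexFamily M N CM δ₀ := fun μ y => biLoc_mono (hM μ y) ((hM 0 0).nonneg (Sum.inl 0)) (min_le_left _ _)
  exact loc_dM hΞd hCΞ hS' hM' hδ₀ (min_le_right _ _) μ y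

/-- [folklore] The DRESSED diagonal symbol `p c ↦ Σ_κ Σ'_u colH K N ν y′ κ u · g κ u p c` of a bi-localised generator family is localised. -/
theorem loc_diagK_dressed {K : MKer (d + 1) (Fib d)} (hK : ∃ δ C : ℝ, 0 < δ ∧ 0 ≤ C ∧ Decays K C δ)
    {g : Fin (d + 1) → (Fin (d + 1) → ℤ) → (Fin (d + 1) → ℤ) → Fib d → ℝ} {Cg m : ℝ} (hgl : LocStencil (fun κ u => diagK (g κ u)) Cg m)
    (hm : 0 < m) (ν : Fin (d + 1)) (y' : Fin (d + 1) → ℤ) :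
    Loc (diagK fun p c => ∑ κ, ∑' u, colH K N ν y' κ u * g κ u p c) := by
  rw [diagK_dressed_eq_vertexOfK]
  obtain ⟨Cv, δv, hδv, hV⟩ := vertexFamily_vertexOfK' (N := N) hK hgl hm
  exact ⟨_, _, Cv, δv, hδv, hV ν y'⟩

/-- [folklore] **SOCKET (hΔL), DRESSED FORM**: with `G := Σ colH K N ν y′ · g` (the contact symbol of `W2OfK_sharp_split`). -/
theorem loc_dM_Xi_dressed [NeZero N] {K 𝕄 : MKer (d + 1) (Fib d)} {C m : ℝ} (hKd : Decays K C m) (hC : 0 ≤ C) (hm : 0 < m) (h𝕄 : Spr 𝕄)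
    {S : Fin (d + 1) → (Fin (d + 1) → ℤ) → MKer (d + 1) (Fib d)} {Cs : ℝ} (hS : LocStencil S Cs m)
    {M : Fin (d + 1) → (Fin (d + 1) → ℤ) → MKer (d + 1) (Fib d)} {CM : ℝ} (hM : VertexFamily M N CM m)
    {g : Fin (d + 1) → (Fin (d + 1) → ℤ) → (Fin (d + 1) → ℤ) → Fib d → ℝ} {Cg : ℝ} (hgl : LocStencil (fun κ u => diagK (g κ u)) Cg m)
    (μ : Fin (d + 1)) (y : Fin (d + 1) → ℤ) (ν : Fin (d + 1)) (y' : Fin (d + 1) → ℤ) :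
    Loc (dM (-(comp (comp K (conjV 𝕄 (diagK fun p c => ∑ κ, ∑' u, colH K N ν y' κ u * g κ u p c))) K)) N S M μ y) :=
  loc_dM_Xi ⟨C, m, hm, hKd⟩ h𝕄 (loc_diagK_dressed ⟨m, C, hm, hC, hKd⟩ hgl hm ν y') hS hm hM μ y

/-! ## §3 (LOC-X₂⋆): socket (hX2L) -/

/-- [folklore] `diagK` is additive in its symbol. -/
theorem diagK_add' (f f' : (Fin (d + 1) → ℤ) → Fib d → ℝ) : (diagK fun p c => f p c + f' p c) = diagK f + diagK f' := by
  classical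
  funext x z a b
  simp only [diagK_apply, Pi.add_apply]
  split_ifs <;> simp

/-- [folklore] The DOUBLY DRESSED diagonal symbol is the second-order chain-rule vertex of the diagonal bi-family (entrywise). -/
theorem diagK_dressed₂_eq_vertex2OfK (K : MKer (d + 1) (Fib d)) (N : ℕ)
    (h : Fin (d + 1) → (Fin (d + 1) → ℤ) → Fin (d + 1) → (Fin (d + 1) → ℤ) → (Fin (d + 1) → ℤ) → Fib d → ℝ)
    (μ : Fin (d + 1)) (y : Fin (d + 1) → ℤ) (ν : Fin (d + 1)) (y' : Fin (d + 1) → ℤ) :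
    diagK (fun p c => ∑ κ, ∑' u, colH K N μ y κ u * ∑ κ', ∑' u', colH K N ν y' κ' u' * h κ u κ' u' p c) =
      vertex2OfK K N (fun κ u κ' u' => diagK (h κ u κ' u')) μ y ν y' := by
  classical
  funext x z a b
  simp only [SecondOrderResponse.vertex2OfK, vertexOfK, OneStepResolventKernel.wsum, diagK_apply]
  by_cases hx : x = z ∧ a = b
  · simp only [if_pos hx]
  · simp only [if_neg hx, mul_zero, tsum_zero, Finset.sum_const_zero]

/-- [folklore] **SOCKET (hX2L): THE DISPLAYED SECOND SYMBOL OF THE ♯-SPLIT IS LOCALISED** —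
`Loc (diagK (p c ↦ (Σ_κ Σ'_u colH K N μ y κ u · Σ_κ′ Σ'_u′ colH K N ν y′ κ′ u′ · h κ u κ′ u′ p c) + Σ_κ Σ'_u colH (K2OfK … + Ξ) N μ y κ u · g κ u p c))`
from decaying `K`, spread `𝕄`, local `S`, coarse-local `M`, bi-localised `g` and the BI-LOCALISED second symbol family
`LocStencil₂ (κ u κ′ u′ ↦ diagK (h κ u κ′ u′)) Ch m`. -/
theorem loc_diagK_secondSymbol [NeZero N] {K 𝕄 : MKer (d + 1) (Fib d)} {C m : ℝ} (hKd : Decays K C m) (hC : 0 ≤ C) (hm : 0 < m)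
    (h𝕄 : Spr 𝕄) {S : Fin (d + 1) → (Fin (d + 1) → ℤ) → MKer (d + 1) (Fib d)} {Cs : ℝ} (hS : LocStencil S Cs m)
    {M : Fin (d + 1) → (Fin (d + 1) → ℤ) → MKer (d + 1) (Fib d)} {CM : ℝ} (hM : VertexFamily M N CM m)
    {g : Fin (d + 1) → (Fin (d + 1) → ℤ) → (Fin (d + 1) → ℤ) → Fib d → ℝ} {Cg : ℝ} (hgl : LocStencil (fun κ u => diagK (g κ u)) Cg m)
    {h : Fin (d + 1) → (Fin (d + 1) → ℤ) → Fin (d + 1) → (Fin (d + 1) → ℤ) → (Fin (d + 1) → ℤ) → Fib d → ℝ} {Ch : ℝ}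
    (hhl : LocStencil₂ (fun κ u κ' u' => diagK (h κ u κ' u')) Ch m)
    (μ : Fin (d + 1)) (y : Fin (d + 1) → ℤ) (ν : Fin (d + 1)) (y' : Fin (d + 1) → ℤ) :
    Loc (diagK fun p c => (∑ κ, ∑' u, colH K N μ y κ u * ∑ κ', ∑' u', colH K N ν y' κ' u' * h κ u κ' u' p c) +
      ∑ κ, ∑' u, colH (K2OfK K N S M ν y' +
        -(comp (comp K (conjV 𝕄 (diagK fun p c => ∑ κ, ∑' u, colH K N ν y' κ u * g κ u p c))) K)) N μ y κ u * g κ u p c) := by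
  rw [diagK_add']
  refine Loc.add ?_ ?_
  · -- the doubly dressed part: the second-order chain-rule vertex of the diagonal bi-family
    rw [diagK_dressed₂_eq_vertex2OfK]
    have hW := vertexFamily₂_vertex2OfK (N := N) hKd hC hhl hm
    exact ⟨_, _, _, _, by positivity, hW μ y ν y'⟩
  · -- the part dressed by the ♯-differentiated inverse: a chain-rule vertex of the diagonal family over a localised kernel
    rw [diagK_dressed_eq_vertexOfK]
    have hK2 : Loc (K2OfK K N S M ν y') := ⟨_, _, _, _, by positivity, vertexFamily_K2OfK hKd hC hm hS hM ν y'⟩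
    have hΞ := loc_Xi ⟨C, m, hm, hKd⟩ h𝕄 (loc_diagK_dressed (N := N) ⟨m, C, hm, hC, hKd⟩ hgl hm ν y')
    obtain ⟨p, q, C', δ', hδ', hL⟩ := hK2.add hΞ
    have hK' : ∃ δ C : ℝ, 0 < δ ∧ 0 ≤ C ∧ Decays (K2OfK K N S M ν y' +
        -(comp (comp K (conjV 𝕄 (diagK fun p c => ∑ κ, ∑' u, colH K N ν y' κ u * g κ u p c))) K)) C δ :=
      ⟨δ', _, hδ', mul_nonneg (hL.nonneg (Sum.inl 0)) (Real.exp_pos _).le, decays_of_biLoc hL hδ'.le⟩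
    obtain ⟨Cv, δv, hδv, hV⟩ := vertexFamily_vertexOfK' (N := N) hK' hgl hm
    exact ⟨_, _, Cv, δv, hδv, hV μ y⟩

end Summit.QuantumFields.BalabanUV.Beta.SecondOrderSplitLoc

end
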